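import Summits.HodgeConjecture.HodgeConjecture.Theorems.Ring2AbelianAllAndreWeilFieldTransport
import Summits.HodgeConjecture.HodgeConjecture.Theorems.Ring2AbelianAllAndreAnchoredPencils
import Summits.HodgeConjecture.HodgeConjecture.Theorems.Ring2AbelianAllAndreInvariantHodgeTypes
import Summits.HodgeConjecture.HodgeConjecture.Theorems.Ring2TransportWeilTypeGeneralCMFieldSU
import Literature.AlgebraicGeometry.HodgeTheory.WeilClassesFieldOneClass
import Literature.AlgebraicGeometry.Deligne1982.WeilTypeCMWeilClassesHodge
import HarnessLib

/-!
# Ring 2 · AbelianAll — ANDRÉ AXIS, PART R-b: THE ANDRÉ AXIS FOR CM FIELDS — on a compact pencil of abelian varieties with a global `E`-action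
  (`E = ℚ(φ) ≅ ℚ[T]/(P)` a number field of ANY degree acting on the charted members), `B⋆` of the ONE total space and ONE anchored member give
  the algebraicity of the WHOLE space of Weil classes `W_E(A_s, φ_s) ⊗ ℂ = weilClassesField (A s) (φ s) P (2m)` of EVERY member (fact-free);
  `⟺` modulo Verdier; the Hodge conjecture itself for the members with Hodge group `SU(φ)` modulo the Deligne–Milne endnote

HONEST FRAMING (page 1, verbatim): **research route, not a corollary; conditional on HC_CM plus one named minimal statement.** Cell line:
research route conditional on HC_CM; not a corollary; Q11.4-sentence-2 already refuted in dim ≥ 3. Nothing in this file proves a case of the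
Hodge conjecture or of `B(X)` for a named `X`: the rows are IMPLICATIONS with displayed hypotheses. `HC_CM`, `HC_AV` and the global nodes do NOT
occur. NAMED-FACT BINDERS: `hGT` = Verdier 1976 (the `⟸` halves only); `h24` = `Deligne1982_hodgeRing_weilTypeCM_of_hodgeGroupSU` (the Deligne–Milne
endnote 16 / Milne 2025 Ex. 1.17, UNREFEREED for `[E:ℚ] ≥ 4`; §4 only). Item `Theses.RankFourFaces.CMToAbelian` (stmt-16267) stays OPEN; N104
untouched; no node is born (0 `def`, 0 `sorry`). Seat `pub-hodge-ring2-ab-andre-2`, gen 48 (part R).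

PARTS M-d / N §3 / O–Q (gens 43–47) did this for `K = ℚ(√−d)` (`weilClassesOf = E₊ ⊕ E₋`, one global class `U₊` on the line `E₊`): `B⋆(𝒳, η) ∀η` +
`K`-action + one chart satisfying HC ⟹ `W(A_s, φ_s) ⊆ Nⁿ(A_s)` for every member. THIS FILE replaces `ℚ(√−d)` by a field `E = ℚ(φ)` of any degree
`e` (`P(φ_s) = 0` on every chart, `P ∈ ℤ[T]` irreducible of degree `e`, `e · 2m = 2 · dim`), the Weil plane by Moonen–Zarhin's `W_E ⊗ ℂ =
⊕_σ ⋀^{2m} V_{ℂ,σ}` (`weilClassesField`, an `E`-LINE `⋀^{2m}_E H¹`), and van Geemen's «one algebraic Weil class + conjugation» by the ONE-CLASS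
LEMMA of the tree (`weilClassesField_le_algebraicClasses_of_isRationalClass_of_ne_zero`: `E` acts on `H^•(A, ℚ)` by algebraic correspondences and
`dim_E W_E = 1`, [Markman 2025, §4; Moonen–Zarhin 1998 §1]). Inputs: part R-a (`W_E ⊗ ℂ` is flat for the global `E`-action), part M-c
(`map_fiberι_mem_algebraicClasses_of_lefschetzB`: `B⋆` transports algebraicity of invariant classes between members, fact-free), flat sections
vanish nowhere, the anchored exactness of part M-c for `⟸`.

## Content (theorems only; standard axioms)

* §1 **`weilClassesField_le_algebraicClasses_forall_of_lefschetzB_of_mem_algebraicClasses`** — THE CORE ROW (fact-free): compact pencil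
  `f : 𝒳 ⟶ S` of abelian `d`-folds with `B⋆(𝒳, η) ∀η`, a global endomorphism `Φ` over `S`, charts `(A_s, e_s, φ_s)` with `e_s ∘ φ_s = Φ_s ∘ e_s` and
  `P(φ_s) = 0`, a RATIONAL global class `U ∈ H^{2m}(𝒳(ℂ); ℂ)` with `e_t^*(U|X_t) ∈ W_E(A_t, φ_t) ⊗ ℂ`, `U|X_t ≠ 0`, and `U|X_{s₀}` ALGEBRAIC at ONE
  member ⟹ **`W_E(A_s, φ_s) ⊗ ℂ ⊆ Nᵐ(A_s)` for EVERY member `s`**. No θ_N, no group law, no rank data, no Verdier, no Weil-type hypothesis, no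
  `HC_CM`. **`…_of_lefschetzB_of_weilClassesField_le_chart`** — the same with the anchor «`W_E(A_{s₀}, φ_{s₀}) ⊗ ℂ` algebraic».
* §2 **`weilClassesField_le_algebraicClasses_forall_of_lefschetzB_of_hodgeConjectureFor_weilTypeCM_chart`** — the anchor = a chart of Weil type
  relative to the CM field `E` (`IsWeilTypeCM`, Deligne's `a_σ = d/2`) satisfying the Hodge conjecture (its `W_E ⊗ ℂ` is then algebraic:
  `IsWeilTypeCM.weilClassesField_le_algebraicClasses_of_hodgeConjectureFor`, Moonen–Zarhin's criterion being a theorem of the tree).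
* §3 **`lefschetzB_weilFieldPencil_iff_forall_weilClassesField_algebraic_of_verdier`** — the `⟺` row: with the Tankeev data (θ_N-datum `ν`,
  `S`-group law charted at `t`, no odd invariants) and the member hypothesis «every monodromy-invariant class of `A_s` lies in the algebra
  generated by the divisor classes and `W_E(A_s) ⊗ ℂ`» (`Deligne1982.divisorWeilAlgebra`, the Deligne–Milne shape of the invariant ring of a CM-field
  Weil family), through an anchor chart with algebraic `W_E`: **`B⋆(𝒳, η) ∀η ⟺ W_E(A_s, φ_s) ⊗ ℂ ⊆ Nᵐ(A_s)` for every `s`**, modulo Verdier for `⟸`.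
* §4 **`hodgeConjectureFor_member_of_lefschetzB_of_hasHodgeGroupSUCM`** — the SUMMIT'S OWN PREDICATE for members: under §1's hypotheses,
  `HodgeConjectureFor (A s).dim (A s).X` for every member `(A_s, φ_s, h_s)` of Weil type (CM) whose degree-one Hodge group is `SU(φ)` at a
  Rosati-compatible polarization class — modulo the Deligne–Milne endnote (`h24`, unrefereed for `[E:ℚ] ≥ 4`; the transport seat's
  `hodgeConjectureFor_weilTypeCM_of_weilClassesField` with its Weil-class input supplied by §1).

## What is new, and the habitat it opens (honest)

For `E = ℚ(√−d)` the rows are parts M-d/N/O–Q. For `[E:ℚ] = 2e₀ ≥ 4` the Weil classes `⋀^{2k}_E H¹(A, ℚ) ⊂ H^{2k}(A, ℚ)` have CODIMENSION `k`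
on an abelian variety of dimension `2k·e₀`: the smallest new instance is `k = 2`, `e₀ = 2` — **codimension-2 Weil classes on abelian EIGHTFOLDS with
multiplication by a quartic CM field**, and the row reads: **`B⋆` of the ONE 9-fold total space of a compact pencil of such eightfolds with its
`E`-action, through one anchored member, ⟹ the `E`-Weil classes of EVERY member are algebraic.** In print these classes are OPEN even on the
split components — «When `E⁺ = ℚ`, such classes have recently been shown to be algebraic [Ma]. For other fields `E⁺`, these motivated classes are
not known to be algebraic (nor Künneth-algebraic)» [Andre2026ReesMotives, §4.4.4] — and Markman's CM-field companion reduces them to an instance of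
the variational Hodge conjecture [Markman2025SurveySecant, §4]; André's Lemme 6.3.3 supplies, for SPLIT `E`-Weil structures, compact pencils
through a power of an elliptic curve carrying the Weil class as a global section (tree: `andre1996_splitWeilClasses_algebraicallyAnchoredPencil`,
a named fact NOT used here). ANCHORS for §2 exist in the tree unconditionally at tensor points and elliptic powers (HC for powers of a CM elliptic
curve); which `E`-components (signature, discriminant in `E⁺ˣ/N(Eˣ)`) contain such anchors is NOT decided here (owed, (o156)). Existence of compact
pencils with a global `E`-action through a given member is NOT constructed (hypotheses, as on the whole axis). Nothing minimal claimed; N104 untouched.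
EDGE LABELS: §1–§2 K (fact-free); §3 K[Verdier] for `⟸`; §4 K[h24].
References: MoonenZarhin1998WeilClasses (§1: `W_F`, `dim_F W_F = 1`, Criterion); Markman2025SurveySecant (§4 pp. 9–10, the one-class sentence);
Deligne1982HodgeCycles (§4 (4.4), Prop. 4.4, proof of Thm. 4.8; Milne 2003 re-edition endnote 16); Andre1996Motifs (§6.3 Lemme 6.3.3, Remarque 2,
p. 33); Andre2026ReesMotives (§4.4.4); Tankeev2008 (Thm. (i)–(ii)); Verdier1976 (Cor. (5.1)); Abdulali1994FamiliesAV ((1.1), Thm. 5.5);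
Milne2025AbelianMotivesCharP (Ex. 1.17).
-/

noncomputable section

set_option linter.dupNamespace false

namespace Summit.HodgeConjecture.HodgeConjecture.Ring2.AbelianAll

open CategoryTheory CategoryTheory.Limits AlgebraicGeometry MonoidalCategory CartesianMonoidalCategory
open Literature.AlgebraicGeometry Literature.AlgebraicGeometry.Motives
open Literature.AlgebraicGeometry.HodgeTheory Literature.AlgebraicGeometry.Deligne1982
open Literature.AlgebraicTopology.SingularHomology (singularCohomology)
open Summit.HodgeConjecture.HodgeConjecture.Ring2Transport (isEvenCupSubalgebra_algebraicClasses hodgeConjectureFor_weilTypeCM_of_weilClassesField)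

variable {𝒳 S : SchemeOver ℂ} {f : 𝒳 ⟶ S} {d : ℕ}

/-! ## §1 The core row: `B⋆` of the one total space + one anchored member ⟹ `W_E ⊗ ℂ` algebraic on every member -/

section Core

/-- **THE ANDRÉ ROW FOR A CM FIELD OF ANY DEGREE (fact-free).** Let `f : 𝒳 ⟶ S` be a compact pencil of abelian `d`-folds with `B⋆(𝒳, η)` for every
`η`, `Φ` a global endomorphism over `S`, `(A_s, e_s, φ_s)` charts with `e_s ∘ φ_s = Φ_s ∘ e_s` and `P(φ_s) = 0` for ONE `P ∈ ℤ[T]` irreducible over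
`ℚ` of degree `e` with `e · 2m = 2d`, `m > 0` (`E = ℚ[T]/(P)` acts on every member; `W_E(A_s) ⊗ ℂ = weilClassesField (A s) (φ s) P (2m)` is the
complexified `E`-line `⋀^{2m}_E H¹`). Let `U ∈ H^{2m}(𝒳(ℂ); ℂ)` be a RATIONAL global class with `e_t^*(U|X_t) ∈ W_E(A_t) ⊗ ℂ` and `U|X_t ≠ 0` at
one member, and suppose `U|X_{s₀}` is ALGEBRAIC at one member `s₀`. THEN `W_E(A_s, φ_s) ⊗ ℂ ⊆ Nᵐ(A_s)` for EVERY member `s`. Proof: `B⋆`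
transports the algebraicity of `U|X_{s₀}` to every `U|X_s` (part M-c, fact-free); `e_s^*(U|X_s)` lies in `W_E(A_s) ⊗ ℂ` (part R-a: `W_E ⊗ ℂ` is
flat for the global `E`-action), is rational and non-zero (flat sections vanish nowhere); ONE non-zero rational algebraic class of the `E`-line
makes the whole line algebraic (`E` acts through algebraic correspondences: the tree's one-class lemma). No θ_N, no group law, no rank data, no
Verdier, no Weil-type hypothesis, no `HC_CM`. [cite: MoonenZarhin1998WeilClasses, §1 (dim_F W_F = 1; W_F ⊗ ℂ = ⊕_σ ⋀^r V_{ℂ,σ})]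
[cite: Markman2025SurveySecant, §4 (pp. 9–10)] [cite: Andre1996Motifs, §6.3 Lemme 6.3.3 (iii) and Remarque 2 (p. 33)]
[cite: Abdulali1994FamiliesAV, (1.1) and Theorem 5.5 (p. 1130)] [cite: Deligne1982HodgeCycles, §4 proof of Thm. 4.8 (pp. 48–50)] -/
theorem weilClassesField_le_algebraicClasses_forall_of_lefschetzB_of_mem_algebraicClasses
    (hf : IsCompactAbelianPencil f d) (hB : ∀ ηX : complexBetti 𝒳 2, StandardConjectureBStar (d + 1) 𝒳 ηX)
    (Φ : 𝒳 ⟶ 𝒳) (hΦ : Φ ≫ f = f)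
    (A : ComplexPoints S → AbelianVariety ℂ) (e : ∀ s, (A s).X ≅ fiberOver f s) (φ : ∀ s, A s ⟶ A s)
    (hK : ∀ s, ∃ Φs : fiberOver f s ⟶ fiberOver f s, Φs ≫ fiberι f s = fiberι f s ≫ Φ ∧ (e s).hom ≫ Φs = (φ s).hom.hom.hom ≫ (e s).hom)
    {P : Polynomial ℤ} {eP m : ℕ} (hPe : P.natDegree = eP) (hPirr : Irreducible (P.map (Int.castRingHom ℚ)))
    (hP : ∀ s, Polynomial.eval₂ (Int.castRingHom (CategoryTheory.End (A s))) ((φ s : CategoryTheory.End (A s))) P = 0)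
    (her : eP * (2 * m) = 2 * d) (hm : 0 < m)
    (U : complexBetti 𝒳 (2 * m)) (hUQ : IsRationalClass U) {t : ComplexPoints S}
    (hUt : complexBetti.map (e t).hom (2 * m) (complexBetti.map (fiberι f t) (2 * m) U) ∈ weilClassesField (A t) (φ t) P (2 * m))
    (hU0 : complexBetti.map (fiberι f t) (2 * m) U ≠ 0)
    {s₀ : ComplexPoints S} (hU₀ : complexBetti.map (fiberι f s₀) (2 * m) U ∈ algebraicClasses (fiberOver f s₀) m)
    (s : ComplexPoints S) :
    weilClassesField (A s) (φ s) P (2 * m) ≤ algebraicClasses (A s).X m := by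
  -- `e > 0` (an irreducible polynomial is not constant), hence `m ≤ d`
  have heP : 0 < eP := by
    rw [← hPe]
    by_contra h0
    have hdeg : P.natDegree = 0 := by omega
    have hdegQ : (P.map (Int.castRingHom ℚ)).natDegree = 0 := by
      rw [Polynomial.natDegree_map_eq_of_injective (RingHom.injective_int (Int.castRingHom ℚ)), hdeg]
    exact hPirr.not_isUnit (Polynomial.isUnit_iff_degree_eq_zero.2
      (Polynomial.degree_eq_natDegree hPirr.ne_zero ▸ by rw [hdegQ]; rfl))
  have hmd : m ≤ d := by nlinarith
  -- `U|X_s` is algebraic on the member (B⋆ transport from the anchor), and on the chart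
  have halg : complexBetti.map (e s).hom (2 * m) (complexBetti.map (fiberι f s) (2 * m) U) ∈ algebraicClasses (A s).X m :=
    (mem_algebraicClasses_map_iff_of_iso (e s)).2 (map_fiberι_mem_algebraicClasses_of_lefschetzB hf hB hmd U hU₀ s)
  -- it lies in `W_E(A_s) ⊗ ℂ` (part R-a), is rational and non-zero
  have hW : complexBetti.map (e s).hom (2 * m) (complexBetti.map (fiberι f s) (2 * m) U) ∈ weilClassesField (A s) (φ s) P (2 * m) :=
    map_chart_fiberι_mem_weilClassesField_member_of_member hf Φ hΦ A e φ hK U hUt s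
  have hQ : IsRationalClass (complexBetti.map (e s).hom (2 * m) (complexBetti.map (fiberι f s) (2 * m) U)) :=
    (isRationalClass_map_iff_of_iso (e s)).2 (hUQ.map (AlgPoints.mapContinuous (L := ℂ) (fiberι f s)))
  have h0 : complexBetti.map (e s).hom (2 * m) (complexBetti.map (fiberι f s) (2 * m) U) ≠ 0 :=
    complexBetti.map_ne_zero_of_iso (e s) (2 * m) (map_fiberι_ne_zero_of_ne_zero hf hU0 s)
  -- dimension of the chart and the one-class lemma
  have hdim : (A s).dim = d := Andre1996.compactPencil_dim_eq_of_iso hf (e s)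
  exact weilClassesField_le_algebraicClasses_of_isRationalClass_of_ne_zero hPe hPirr (hP s) (by rw [hdim]; exact her) hm hW hQ h0 halg

/-- **The same with the anchor «the Weil classes of ONE chart are algebraic»**: if `W_E(A_{s₀}, φ_{s₀}) ⊗ ℂ ⊆ Nᵐ(A_{s₀})` at one member (a chart
satisfying the Hodge conjecture, §2; a tensor point; a power of a CM elliptic curve), then `W_E(A_s, φ_s) ⊗ ℂ ⊆ Nᵐ(A_s)` at every member. Fact-free.
[cite: MoonenZarhin1998WeilClasses, §1] [cite: Andre1996Motifs, §6.3 Lemme 6.3.3 and Remarque 2 (p. 33)] [cite: Abdulali1994FamiliesAV, Theorem 5.5 (p. 1130)] -/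
theorem weilClassesField_le_algebraicClasses_forall_of_lefschetzB_of_weilClassesField_le_chart
    (hf : IsCompactAbelianPencil f d) (hB : ∀ ηX : complexBetti 𝒳 2, StandardConjectureBStar (d + 1) 𝒳 ηX)
    (Φ : 𝒳 ⟶ 𝒳) (hΦ : Φ ≫ f = f)
    (A : ComplexPoints S → AbelianVariety ℂ) (e : ∀ s, (A s).X ≅ fiberOver f s) (φ : ∀ s, A s ⟶ A s)
    (hK : ∀ s, ∃ Φs : fiberOver f s ⟶ fiberOver f s, Φs ≫ fiberι f s = fiberι f s ≫ Φ ∧ (e s).hom ≫ Φs = (φ s).hom.hom.hom ≫ (e s).hom)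
    {P : Polynomial ℤ} {eP m : ℕ} (hPe : P.natDegree = eP) (hPirr : Irreducible (P.map (Int.castRingHom ℚ)))
    (hP : ∀ s, Polynomial.eval₂ (Int.castRingHom (CategoryTheory.End (A s))) ((φ s : CategoryTheory.End (A s))) P = 0)
    (her : eP * (2 * m) = 2 * d) (hm : 0 < m)
    (U : complexBetti 𝒳 (2 * m)) (hUQ : IsRationalClass U) {t : ComplexPoints S}
    (hUt : complexBetti.map (e t).hom (2 * m) (complexBetti.map (fiberι f t) (2 * m) U) ∈ weilClassesField (A t) (φ t) P (2 * m))
    (hU0 : complexBetti.map (fiberι f t) (2 * m) U ≠ 0)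
    {s₀ : ComplexPoints S} (hWalg₀ : weilClassesField (A s₀) (φ s₀) P (2 * m) ≤ algebraicClasses (A s₀).X m)
    (s : ComplexPoints S) :
    weilClassesField (A s) (φ s) P (2 * m) ≤ algebraicClasses (A s).X m :=
  weilClassesField_le_algebraicClasses_forall_of_lefschetzB_of_mem_algebraicClasses hf hB Φ hΦ A e φ hK hPe hPirr hP her hm U hUQ hUt hU0
    ((mem_algebraicClasses_map_iff_of_iso (e s₀)).1
      (hWalg₀ (map_chart_fiberι_mem_weilClassesField_member_of_member hf Φ hΦ A e φ hK U hUt s₀))) s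

end Core

/-! ## §2 The anchor = a chart of Weil type (CM) satisfying the Hodge conjecture -/

section Anchor

/-- **THROUGH A CHART OF WEIL TYPE SATISFYING THE HODGE CONJECTURE** (the CM-field form of part N §3): compact pencil of abelian `d`-folds with
`B⋆(𝒳, η) ∀η`, its global `E`-action (`Φ`, charts `(A_s, e_s, φ_s)` with `P_R(φ_s) = 0`, `P_R = R(T²)`, `E = ℚ(φ)` a CM field of degree `2e₀`), a
rational global `U` on `W_E(A_t) ⊗ ℂ` at `t` with `U|X_t ≠ 0`, and ONE chart `(A_{s₀}, φ_{s₀})` of Weil type relative to `E` (`IsWeilTypeCM`: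
`a_σ = k` at every embedding) satisfying `HodgeConjectureFor` ⟹ `W_E(A_s, φ_s) ⊗ ℂ ⊆ Nᵏ(A_s)` for EVERY member. The anchor's Weil classes are of
type `(k, k)` (Deligne Prop. 4.4 ⟸, via the tree's Moonen–Zarhin criterion), rational ones algebraic by HC, and they span; then §1. Fact-free.
[cite: Deligne1982HodgeCycles, §4 (4.4) and Prop. 4.4] [cite: MoonenZarhin1998WeilClasses, §1 (Criterion)]
[cite: Andre1996Motifs, §6.3 Lemme 6.3.3 and Remarque 2 (p. 33)] [cite: Abdulali1994FamiliesAV, Theorem 5.5 (p. 1130)] -/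
theorem weilClassesField_le_algebraicClasses_forall_of_lefschetzB_of_hodgeConjectureFor_weilTypeCM_chart
    (hf : IsCompactAbelianPencil f d) (hB : ∀ ηX : complexBetti 𝒳 2, StandardConjectureBStar (d + 1) 𝒳 ηX)
    (Φ : 𝒳 ⟶ 𝒳) (hΦ : Φ ≫ f = f)
    (A : ComplexPoints S → AbelianVariety ℂ) (e : ∀ s, (A s).X ≅ fiberOver f s) (φ : ∀ s, A s ⟶ A s)
    (hK : ∀ s, ∃ Φs : fiberOver f s ⟶ fiberOver f s, Φs ≫ fiberι f s = fiberι f s ≫ Φ ∧ (e s).hom ≫ Φs = (φ s).hom.hom.hom ≫ (e s).hom)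
    {R : Polynomial ℤ} {e₀ k : ℕ}
    (hP : ∀ s, Polynomial.eval₂ (Int.castRingHom (CategoryTheory.End (A s))) ((φ s : CategoryTheory.End (A s)))
      (R.comp (Polynomial.X ^ 2)) = 0)
    (U : complexBetti 𝒳 (2 * k)) (hUQ : IsRationalClass U) {t : ComplexPoints S}
    (hUt : complexBetti.map (e t).hom (2 * k) (complexBetti.map (fiberι f t) (2 * k) U) ∈
      weilClassesField (A t) (φ t) (R.comp (Polynomial.X ^ 2)) (2 * k))
    (hU0 : complexBetti.map (fiberι f t) (2 * k) U ≠ 0)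
    {s₀ : ComplexPoints S} (hW₀ : IsWeilTypeCM (A s₀) (φ s₀) R e₀ k) (hHC₀ : HodgeConjectureFor (A s₀).dim (A s₀).X)
    (s : ComplexPoints S) :
    weilClassesField (A s) (φ s) (R.comp (Polynomial.X ^ 2)) (2 * k) ≤ algebraicClasses (A s).X k := by
  have hdim₀ : (A s₀).dim = d := Andre1996.compactPencil_dim_eq_of_iso hf (e s₀)
  have her : (2 * e₀) * (2 * k) = 2 * d := by rw [← hdim₀, hW₀.dim_eq]; ring
  exact weilClassesField_le_algebraicClasses_forall_of_lefschetzB_of_weilClassesField_le_chart hf hB Φ hΦ A e φ hK hW₀.natDegree_comp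
    hW₀.irreducible hP her hW₀.k_pos U hUQ hUt hU0 (hW₀.weilClassesField_le_algebraicClasses_of_hodgeConjectureFor hHC₀) s

end Anchor

/-! ## §3 The `⟺` row: `B⋆` of the one total space ⟺ the `E`-Weil classes of every member are algebraic (Tankeev data; Verdier for `⟸`) -/

section Iff

open scoped MonObj

/-- `𝒴` — the fibre square `𝒳 ×_S 𝒳` (display notation for the tree's `familyPullback f f`). -/
local notation3 (prettyPrint := false) "𝒴[" f "]" => familyPullback f f
/-- `𝐚` — the first projection `𝒳 ×_S 𝒳 ⟶ 𝒳`. -/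
local notation3 (prettyPrint := false) "𝐚[" f "]" => familyPullback.fst f f
/-- `𝐛` — the second projection `𝒳 ×_S 𝒳 ⟶ 𝒳`. -/
local notation3 (prettyPrint := false) "𝐛[" f "]" => familyPullback.snd f f

/-- **`B⋆` OF THE ONE TOTAL SPACE `⟺` THE `E`-WEIL CLASSES OF EVERY MEMBER ARE ALGEBRAIC.** Compact pencil `f : 𝒳 ⟶ S` of abelian `(n+1)`-folds
with the Tankeev data (θ_N-datum `ν`, an `S`-group law `mS` charted at `t`, no odd invariants at `t`), its global `E`-action (`Φ`, charts
`(A_s, e_s, φ_s)` with `P(φ_s) = 0`, `P` irreducible of degree `e`, `e · 2m = 2(n+1)`), a rational global `U` on `W_E(A_t) ⊗ ℂ` with `U|X_t ≠ 0`,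
an ANCHOR chart `s₀` with `W_E(A_{s₀}) ⊗ ℂ` algebraic, and the member hypothesis «every monodromy-invariant class of every member lies in the algebra
generated by the divisor classes and `W_E ⊗ ℂ`» (`Deligne1982.divisorWeilAlgebra` — the shape of the invariant ring of a Weil family with Hodge group
`Res_{E⁺/ℚ} SU(φ)`, a HYPOTHESIS here). THEN `B⋆(𝒳, η) ∀η ⟺ W_E(A_s, φ_s) ⊗ ℂ ⊆ Nᵐ(A_s)` for every member. ⟹ is §1 (fact-free); ⟸: every
invariant class of every member is then algebraic (divisor classes by Lefschetz (1,1), cup products on abelian varieties, `W_E` by hypothesis: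
`divisorWeilAlgebra_le_algebraicClasses`), and part M-c's anchored exactness (Verdier) gives `B⋆`. [cite: Tankeev2008, Thm. (i)–(ii)]
[cite: Verdier1976, Cor. (5.1)] [cite: Deligne1982HodgeCycles, §4 (4.4) and Milne 2003 re-edition endnote 16] [cite: MoonenZarhin1998WeilClasses, §1] -/
theorem lefschetzB_weilFieldPencil_iff_forall_weilClassesField_algebraic_of_verdier (hGT : Verdier1976_genericLocalTriviality) {n : ℕ}
    (hf : IsCompactAbelianPencil f (n + 1)) (t : ComplexPoints S) (ν : 𝒳 ⟶ 𝒳) (hν : ν ≫ f = f) {N : ℕ} (hN : 2 ≤ N)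
    (hθ : ∀ s : ComplexPoints S, ∃ (νs : fiberOver f s ⟶ fiberOver f s) (A : AbelianVariety ℂ) (e : A.X ≅ fiberOver f s),
      νs ≫ fiberι f s = fiberι f s ≫ ν ∧ e.hom ≫ νs = (N • 𝟙 A).hom.hom.hom ≫ e.hom)
    (mS : 𝒴[f] ⟶ 𝒳)
    (hmν : (familyPullback.isPullback f f).lift (𝐚[f] ≫ ν) (𝐛[f] ≫ ν) (familyPullback_pair_condition hν) ≫ mS = mS ≫ ν)
    (hchart : ∃ (νt : fiberOver f t ⟶ fiberOver f t) (A : AbelianVariety ℂ) (e : A.X ≅ fiberOver f t),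
      νt ≫ fiberι f t = fiberι f t ≫ ν ∧ e.hom ≫ νt = (N • 𝟙 A).hom.hom.hom ≫ e.hom ∧
      (familyPullback.isPullback f f).lift (fst A.X A.X ≫ e.hom ≫ fiberι f t) (snd A.X A.X ≫ e.hom ≫ fiberι f t)
        (fibreChart_pair_condition t e) ≫ mS = μ[A.X] ≫ e.hom ≫ fiberι f t)
    (hOdd : ∀ k' : ℕ, Odd k' → k' ≤ 2 * (n + 1) → ∀ W : complexBetti 𝒳 k', complexBetti.map (fiberι f t) k' W = 0)
    (Φ : 𝒳 ⟶ 𝒳) (hΦ : Φ ≫ f = f)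
    (A : ComplexPoints S → AbelianVariety ℂ) (e : ∀ s, (A s).X ≅ fiberOver f s) (φ : ∀ s, A s ⟶ A s)
    (hK : ∀ s, ∃ Φs : fiberOver f s ⟶ fiberOver f s, Φs ≫ fiberι f s = fiberι f s ≫ Φ ∧ (e s).hom ≫ Φs = (φ s).hom.hom.hom ≫ (e s).hom)
    {P : Polynomial ℤ} {eP m : ℕ} (hPe : P.natDegree = eP) (hPirr : Irreducible (P.map (Int.castRingHom ℚ)))
    (hP : ∀ s, Polynomial.eval₂ (Int.castRingHom (CategoryTheory.End (A s))) ((φ s : CategoryTheory.End (A s))) P = 0)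
    (her : eP * (2 * m) = 2 * (n + 1)) (hm : 0 < m)
    (hInv : ∀ (s : ComplexPoints S) (p : ℕ), 0 < p → p < n + 1 → ∀ W : complexBetti 𝒳 (2 * p),
      complexBetti.map (e s).hom (2 * p) (complexBetti.map (fiberι f s) (2 * p) W) ∈ divisorWeilAlgebra (A s) (φ s) P m p)
    (U : complexBetti 𝒳 (2 * m)) (hUQ : IsRationalClass U)
    (hUt : complexBetti.map (e t).hom (2 * m) (complexBetti.map (fiberι f t) (2 * m) U) ∈ weilClassesField (A t) (φ t) P (2 * m))
    (hU0 : complexBetti.map (fiberι f t) (2 * m) U ≠ 0)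
    {s₀ : ComplexPoints S} (hWalg₀ : weilClassesField (A s₀) (φ s₀) P (2 * m) ≤ algebraicClasses (A s₀).X m) :
    (∀ ηX : complexBetti 𝒳 2, StandardConjectureBStar (n + 1 + 1) 𝒳 ηX) ↔
      ∀ s : ComplexPoints S, weilClassesField (A s) (φ s) P (2 * m) ≤ algebraicClasses (A s).X m := by
  -- every invariant class of a member whose `W_E` is algebraic is algebraic (divisor–Weil generation)
  have hgen : ∀ s : ComplexPoints S, weilClassesField (A s) (φ s) P (2 * m) ≤ algebraicClasses (A s).X m →
      ∀ p : ℕ, 0 < p → p < n + 1 → ∀ W : complexBetti 𝒳 (2 * p),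
        complexBetti.map (fiberι f s) (2 * p) W ∈ algebraicClasses (fiberOver f s) p := fun s hWs p hp0 hp W ↦
    (mem_algebraicClasses_map_iff_of_iso (e s)).1
      (divisorWeilAlgebra_le_algebraicClasses (isEvenCupSubalgebra_algebraicClasses (A s)) hWs p (hInv s p hp0 hp W))
  refine ⟨fun hB s ↦ weilClassesField_le_algebraicClasses_forall_of_lefschetzB_of_weilClassesField_le_chart hf hB Φ hΦ A e φ hK hPe hPirr hP
    her hm U hUQ hUt hU0 hWalg₀ s, fun hW ↦ ?_⟩
  exact (lefschetzB_pencil_iff_forall_algebraicInvariants_of_anchor_of_verdier hGT hf t ν hν hN hθ mS hmν hchart hOdd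
    (hgen s₀ hWalg₀)).2 fun s p hp0 hp W ↦ hgen s (hW s) p hp0 hp W

end Iff

/-! ## §4 The summit's predicate for the members with Hodge group `SU(φ)` (modulo the Deligne–Milne endnote) -/

section Members

/-- **`B⋆` OF THE ONE TOTAL SPACE ⟹ THE HODGE CONJECTURE FOR EVERY GENERAL MEMBER** (modulo `h24`). Under the hypotheses of §1 (compact abelian
pencil with `B⋆(𝒳, η) ∀η`, global `E`-action with `P_R(φ_s) = 0`, a rational global `U` on `W_E(A_t) ⊗ ℂ` with `U|X_t ≠ 0`, one anchored member
`s₀`), EVERY member `(A_s, φ_s)` which is of Weil type relative to `E` with a Rosati-compatible polarization class `h` at which its degree-one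
Hodge group is `SU(φ)` (`HasHodgeGroupSUCM` — the general member, Deligne–Milne endnote 16 / van Geemen 6.11) SATISFIES THE HODGE CONJECTURE:
`HodgeConjectureFor (A s).dim (A s).X`. The Weil-class input of the transport seat's `hodgeConjectureFor_weilTypeCM_of_weilClassesField` (the
endnote's «if the Weil classes are algebraic, then the Hodge conjecture holds for `A`», `h24`, UNREFEREED for `[E:ℚ] ≥ 4`; refereed = van Geemen
6.12 for `[E:ℚ] = 2`) is supplied by §1. [cite: Deligne1982HodgeCycles, Milne 2003 re-edition endnote 16] [cite: Milne2025AbelianMotivesCharP, §1.5 Example 1.17]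
[cite: vanGeemen1994HodgeAV, 6.11–6.12] [cite: MoonenZarhin1998WeilClasses, §1] -/
theorem hodgeConjectureFor_member_of_lefschetzB_of_hasHodgeGroupSUCM (h24 : Deligne1982_hodgeRing_weilTypeCM_of_hodgeGroupSU)
    (hf : IsCompactAbelianPencil f d) (hB : ∀ ηX : complexBetti 𝒳 2, StandardConjectureBStar (d + 1) 𝒳 ηX)
    (Φ : 𝒳 ⟶ 𝒳) (hΦ : Φ ≫ f = f)
    (A : ComplexPoints S → AbelianVariety ℂ) (e : ∀ s, (A s).X ≅ fiberOver f s) (φ : ∀ s, A s ⟶ A s)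
    (hK : ∀ s, ∃ Φs : fiberOver f s ⟶ fiberOver f s, Φs ≫ fiberι f s = fiberι f s ≫ Φ ∧ (e s).hom ≫ Φs = (φ s).hom.hom.hom ≫ (e s).hom)
    {R : Polynomial ℤ} {e₀ k : ℕ}
    (hP : ∀ s, Polynomial.eval₂ (Int.castRingHom (CategoryTheory.End (A s))) ((φ s : CategoryTheory.End (A s)))
      (R.comp (Polynomial.X ^ 2)) = 0)
    (U : complexBetti 𝒳 (2 * k)) (hUQ : IsRationalClass U) {t : ComplexPoints S}
    (hUt : complexBetti.map (e t).hom (2 * k) (complexBetti.map (fiberι f t) (2 * k) U) ∈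
      weilClassesField (A t) (φ t) (R.comp (Polynomial.X ^ 2)) (2 * k))
    (hU0 : complexBetti.map (fiberι f t) (2 * k) U ≠ 0)
    {s₀ : ComplexPoints S} (hU₀ : complexBetti.map (fiberι f s₀) (2 * k) U ∈ algebraicClasses (fiberOver f s₀) k)
    {s : ComplexPoints S} (hWs : IsWeilTypeCM (A s) (φ s) R e₀ k) {h : complexBetti (A s).X 2}
    (hpol : IsPolarizationClass (A s).dim (A s).X h)
    (hRos : ∀ x y : complexBetti (A s).X 1,
      polarizationPairingOne (A s).X h ((A s).dim - 1) (VanGeemen1994.pullbackOne (A s) (φ s) x) y =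
        -polarizationPairingOne (A s).X h ((A s).dim - 1) x (VanGeemen1994.pullbackOne (A s) (φ s) y))
    (hSU : HasHodgeGroupSUCM (A s) (φ s) (R.comp (Polynomial.X ^ 2)) h) :
    HodgeConjectureFor (A s).dim (A s).X := by
  have hdim : (A s).dim = d := Andre1996.compactPencil_dim_eq_of_iso hf (e s)
  have her : (2 * e₀) * (2 * k) = 2 * d := by rw [← hdim, hWs.dim_eq]; ring
  exact hodgeConjectureFor_weilTypeCM_of_weilClassesField h24 hWs hpol hRos hSU
    (weilClassesField_le_algebraicClasses_forall_of_lefschetzB_of_mem_algebraicClasses hf hB Φ hΦ A e φ hK hWs.natDegree_comp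
      hWs.irreducible hP her hWs.k_pos U hUQ hUt hU0 hU₀ s)

end Members

end Summit.HodgeConjecture.HodgeConjecture.Ring2.AbelianAll

end
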